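/-
Copyright (c) 2026 the pub-hodgecm-mathlib formalisation cell (harness21).  Prover seat hodgecm-mathlib-K2Liu-p01 (g6), Track B «K2-LIT»,
Road I organ (A-int)-fin, A2 «mixed-model equivariance of the Kudla–Rallis ∕ Ikeda map», FOURIER CLAUSE (the Weyl element `w_Δ`)
(LEAD F0P6-plan (g12) RULING M-156l (4) «A2a … FOURIER clauses»; heads `K2/K2Liu-p01/g6/HEADS-A2-KudlaRallisMapEquivariance.K2Liu-p01-g6.md` §2).  KERNEL: theorems only.
-/
import Summits.HodgeConjecture.HodgeConjecture.Theorems.K2LiuKudlaRallisMapDefs     -- ★ β-2 p858271 `krPoint`, `krFun`; brings ★ `betaFourier`, ★ p858160 fibre integrals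
import Literature.NumberTheory.Automorphic.LocalPiSchwartzBruhatFourier             -- ★ `piFourierSB`, `piFourierSB_piFourierSB_eq`, `piSelfDualConst`
import Mathlib.MeasureTheory.Integral.Prod
import HarnessLib

/-!
# Crux `HLiu418`, Track B road `K2_Liu`, Road I organ (A-int)-fin — A2, FOURIER CLAUSE: THE KUDLA–RALLIS ∕ IKEDA MAP INTERTWINES THE WEYL ELEMENTS
# `r (𝓕_X Φ) = c · 𝓕_β (r Φ)` (Fourier inversion at `0` along the killed ∕ integrated blocks)

Cell `hodgecm-mathlib`, crux item hLiu418 = `stmt-HodgeConjecture-24832`, route of record `HCCMUnconditional`; squad K2 ∕ K2Liu, prover K2Liu-p01 (g6).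
THEOREMS ONLY (no `def`, no instance, no notation, no named fact, no `sorry`); lane `--supports stmt-HodgeConjecture-24832 --as helper`.

The Weyl element `w_Δ` of the doubled group acts in a Schrödinger model by the `β`-Fourier transform (★ `SchrodingerWeylElement.betaFourier B ψ μ`,
`(𝓕 Φ)(y) = ∫ ψ(B x y) Φ(x) dμ(x)`) [MoeglinVignerasWaldspurger1987, Chap. 2 II.6; Weil1964, n° 13].  In the Kudla–Rallis frame of ★ β-2 (`θ_X : X ≃ₜ K^{(β⊕γ)⊕α}`:
kept block `β = a′⊗ℓ`, killed block `γ = Y′⊗ℓ`, integrated block `α = X′⊗ℓ`) the doubled pairing has the shape «`β` pairs with `β′`, `α` with `γ′`, `γ` with `α′`»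
(`X′` and `Y′` are isotropic, in duality, and orthogonal to `a′`), so on the slice `y = krPoint θ_Y u′ a′` (`γ′`-block `0`):  `B x y = q(x_β, u′) + ⟨x_γ, a′⟩`.
Then [GanQiuTakeda2014, §2.8 «`Ik` is `G_n`-equivariant», §2.9; KudlaRallis1994, §1]:

  `r(𝓕_X Φ)(u′) = ∫_{a′} ∫_X ψ(q(x_β,u′)) ψ(⟨x_γ,a′⟩) Φ(x) = ∫_{a′} 𝓕_γ[g](a′) = c · g(0) = c · 𝓕_β(r Φ)(u′)`,
  `g(x_γ) := ∫_{x_β, x_α} ψ(q(x_β,u′)) Φ(x)`  — Fourier inversion AT `0` on `K^γ` (★ `piFourierSB_piFourierSB_eq`), `c = piSelfDualConst` (`= 1` for the self-dual measure).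

* §1 `integral_piFourierSB_eq_mul_apply_zero` — `∫ 𝓕g dν = c · g(0)` for `g ∈ 𝒮(K^γ)` (★ inversion at `η = 0`).
* §2 `integral_integral_fourierSlice_eq` — THE ANALYTIC CORE on the product `K^γ × (K^β × K^α)` (no frames): for `F ∈ 𝒮`,
  `∫_{a′} ∫_t ψ(q t_β u′) ψ(⟨t_γ, a′⟩) F(t) = c · ∫_u ψ(q u u′) ∫_a F(0,(u,a))`.
* §3 **`krFun_betaFourier_eq`** — THE FOURIER CLAUSE for ★ `krFun`: under the frame hypotheses `hB` (shape of the pairing on the slices) and `hμ` (the `X`-measure is the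
  block product read through `θ_X`), **`krFun θ_Y ν_γ (betaFourier B ψ μ_X Φ) u′ = c · betaFourier q ψ ν_β (krFun θ_X ν_α Φ) u′`**.
With ★ A2a (`K2LiuKudlaRallisMapEquivariance`: `M_Δ`, `N_Δ`, `P′_w`, Heisenberg clauses) this completes «`r_w` is `U(W)_w × P′_w`-equivariant» (RULING M-156l) at the
level of the generating operators; the instantiation at ★ β-1 `localSchrodingerDelta` with the frame `θ_w` BY NAME is file A2c.

HONEST LABEL: HC_CM is proved only modulo the printed citations (2 remaining named inputs: hLiu418 = stmt-HodgeConjecture-24832, h413 = stmt-HodgeConjecture-24833)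
until rung 0 closes; generic helper, closes no item.
References: [GanQiuTakeda2014] Invent. Math. 198 (2014) §2.7–2.9 (arXiv:1207.4709 pp. 9–10); [KudlaRallis1994] §1; [MoeglinVignerasWaldspurger1987] Chap. 2 II.6, Chap. 3 IV;
[Weil1964] n° 11, n° 13; [WeilBNT1967] Ch. VII §2 Prop. 2, Cor. 1; [Tate1950] Thm. 2.2.2.
-/

set_option autoImplicit false
set_option linter.dupNamespace false -- the mandated namespace repeats `HodgeConjecture.HodgeConjecture`

noncomputable section

open MeasureTheory MeasureTheory.Measure Topology
open scoped NNReal ENNReal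
open Literature.NumberTheory.Automorphic Literature.RepresentationTheory.HeisenbergGroup
open Summit.HodgeConjecture.HodgeConjecture.Cruxes.HLiu418.K2LiuSchwartzBruhatFiberIntegral
open Summit.HodgeConjecture.HodgeConjecture.Cruxes.HLiu418.K2LiuKudlaRallisMapDefs

namespace Summit.HodgeConjecture.HodgeConjecture.Cruxes.HLiu418.K2LiuKudlaRallisMapFourier

variable {K : Type*} [Field K] [ValuativeRel K] [TopologicalSpace K] [IsNonarchimedeanLocalField K] [SecondCountableTopology K] [T2Space K]
  {α β γ : Type*} [Fintype β] [Fintype γ] [Fintype α]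
  [MeasurableSpace (β → K)] [BorelSpace (β → K)] [MeasurableSpace (α → K)] [BorelSpace (α → K)]
  [MeasurableSpace (γ → K)] [BorelSpace (γ → K)]
  (νβ : Measure (β → K)) [IsFiniteMeasureOnCompacts νβ] [SFinite νβ] (να : Measure (α → K)) [IsFiniteMeasureOnCompacts να] [SFinite να]
  (νγ : Measure (γ → K)) [νγ.IsAddHaarMeasure]
  {ψ : AddChar K Circle} {m : ℤ}

/-! ## §1 Fourier inversion evaluated at `0`: `∫ 𝓕g = c · g(0)` -/

omit [SecondCountableTopology K] [T2Space K] in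
/-- **`∫_{K^γ} (𝓕g)(η) dν(η) = c · g(0)`** for `g ∈ 𝒮(K^γ)`, `c = ν(𝒪^γ) ν((𝔭^m)^γ)` the ★ self-duality constant (`= 1` for the self-dual `ν`): the ★ inversion
formula `𝓕(𝓕g)(z) = c · g(−z)` at `z = 0`. [cite: WeilBNT1967, Ch. VII §2 Cor. 1] [cite: Tate1950, Thm. 2.2.2] -/
theorem integral_piFourierSB_eq_mul_apply_zero (hψ : ψ.IsContinuousNontrivial) (hm : ψ.HasConductorExp m) {g : (γ → K) → ℂ}
    (hg : g ∈ SchwartzBruhat (γ → K)) :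
    ∫ η, piFourierSB ψ νγ g η ∂νγ = (piSelfDualConst K γ νγ m : ℂ) * g 0 := by
  have h := congr_fun (piFourierSB_piFourierSB_eq νγ hψ hm hg) 0
  rw [piFourierSB_apply, neg_zero] at h
  simp_rw [dotProduct_zero, AddChar.map_zero_eq_one, Circle.coe_one, one_mul] at h
  exact h

/-! ## §2 The analytic core on `K^γ × (K^β × K^α)` -/

section Core

variable {W : Type*} [AddCommGroup W] [Module K W] (q : (β → K) →ₗ[K] W →ₗ[K] K)

omit [SecondCountableTopology K] [T2Space K] [Fintype β] [Fintype γ] [Fintype α] [MeasurableSpace (β → K)] [BorelSpace (β → K)]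
  [MeasurableSpace (α → K)] [BorelSpace (α → K)] [MeasurableSpace (γ → K)] [BorelSpace (γ → K)] in
/-- the `q`-modulated function `(c, (u, a)) ↦ ψ(q u u′) F(c, (u, a))` is Schwartz–Bruhat with `F`. [cite: MoeglinVignerasWaldspurger1987, Chap. 2 I.4] -/
theorem modulation_mul_mem (hψ : ψ.IsContinuousNontrivial) (hq : ∀ w : W, Continuous fun u : β → K => q u w) (u' : W)
    {F : (γ → K) × ((β → K) × (α → K)) → ℂ} (hF : F ∈ SchwartzBruhat ((γ → K) × ((β → K) × (α → K)))) :
    (fun t : (γ → K) × ((β → K) × (α → K)) => ((ψ (q t.2.1 u') : Circle) : ℂ) * F t) ∈ SchwartzBruhat ((γ → K) × ((β → K) × (α → K))) := by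
  have h1 : IsLocallyConstant fun t : (γ → K) × ((β → K) × (α → K)) => ((ψ (q t.2.1 u') : Circle) : ℂ) :=
    ((isLocallyConstant_of_isContinuousNontrivial hψ).comp_continuous ((hq u').comp (continuous_fst.comp continuous_snd))).comp ((↑) : Circle → ℂ)
  exact ⟨h1.mul hF.1, hF.2.mul_left⟩

omit [BorelSpace (γ → K)] [Fintype β] [Fintype γ] [MeasurableSpace (γ → K)] [SFinite νβ] [SFinite να] in
/-- the slice `(u, a) ↦ ψ(q u u′) F(c₀, (u, a))` is Schwartz–Bruhat, hence integrable. [cite: Weil1964, n° 11] -/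
theorem integrable_modulation_slice (hψ : ψ.IsContinuousNontrivial) (hq : ∀ w : W, Continuous fun u : β → K => q u w) (u' : W)
    {F : (γ → K) × ((β → K) × (α → K)) → ℂ} (hF : F ∈ SchwartzBruhat ((γ → K) × ((β → K) × (α → K)))) (c₀ : γ → K) :
    Integrable (fun s : (β → K) × (α → K) => ((ψ (q s.1 u') : Circle) : ℂ) * F (c₀, s)) (νβ.prod να) := by
  have hs : (fun s : (β → K) × (α → K) => ((ψ (q s.1 u') : Circle) : ℂ) * F (c₀, s)) ∈ SchwartzBruhat ((β → K) × (α → K)) :=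
    comp_isClosedEmbedding_mem_schwartzBruhat (f := fun t : (γ → K) × ((β → K) × (α → K)) => ((ψ (q t.2.1 u') : Circle) : ℂ) * F t)
      (Function.LeftInverse.isClosedEmbedding (f := Prod.snd) (g := Prod.mk c₀) (fun _ => rfl) continuous_snd (continuous_const.prodMk continuous_id))
      (modulation_mul_mem q hψ hq u' hF)
  exact integrable_of_mem_schwartzBruhat _ hs

/-- **THE ANALYTIC CORE OF THE FOURIER CLAUSE** (pure product-space statement): for `F ∈ 𝒮(K^γ × (K^β × K^α))`, a pairing `q` on the `β`-block, `ψ` continuous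
non-trivial of conductor exponent `m`, `ν_γ` Haar:
`∫_{a′} ∫_{(c,(u,a))} ψ(q u u′) ψ(⟨c, a′⟩) F = c_ψ · ∫_u ψ(q u u′) ∫_a F(0,(u,a))` — the `(c, a′)`-double integral is Fourier inversion at `0` applied to the
Schwartz–Bruhat fibre integral `g(c) = ∫_{(u,a)} ψ(q u u′) F(c,(u,a))` (★ p858160). [cite: GanQiuTakeda2014, §2.8] [cite: KudlaRallis1994, §1] [cite: WeilBNT1967, Ch. VII §2 Cor. 1] -/
theorem integral_integral_fourierSlice_eq (hψ : ψ.IsContinuousNontrivial) (hm : ψ.HasConductorExp m)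
    (hq : ∀ w : W, Continuous fun u : β → K => q u w) (u' : W)
    {F : (γ → K) × ((β → K) × (α → K)) → ℂ} (hF : F ∈ SchwartzBruhat ((γ → K) × ((β → K) × (α → K)))) :
    ∫ a' : γ → K, ∫ t : (γ → K) × ((β → K) × (α → K)), ((ψ (q t.2.1 u') : Circle) : ℂ) * (((ψ (t.1 ⬝ᵥ a') : Circle) : ℂ) * F t) ∂(νγ.prod (νβ.prod να)) ∂νγ =
      (piSelfDualConst K γ νγ m : ℂ) * ∫ u : β → K, ((ψ (q u u') : Circle) : ℂ) * (∫ a : α → K, F (0, (u, a)) ∂να) ∂νβ := by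
  -- the modulated function and its `γ`-fibre integral `g`
  have hG := modulation_mul_mem q hψ hq u' hF
  set g : (γ → K) → ℂ := fun c => ∫ s : (β → K) × (α → K), ((ψ (q s.1 u') : Circle) : ℂ) * F (c, s) ∂(νβ.prod να) with hg
  have hgS : g ∈ SchwartzBruhat (γ → K) := integral_prod_right_mem_schwartzBruhat (νβ.prod να) hG
  -- (i) the inner `t`-integral is `𝓕_γ g (a′)`
  have hinner : ∀ a' : γ → K,
      ∫ t : (γ → K) × ((β → K) × (α → K)), ((ψ (q t.2.1 u') : Circle) : ℂ) * (((ψ (t.1 ⬝ᵥ a') : Circle) : ℂ) * F t) ∂(νγ.prod (νβ.prod να)) =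
        piFourierSB ψ νγ g a' := by
    intro a'
    have hint : Integrable (fun t : (γ → K) × ((β → K) × (α → K)) => ((ψ (q t.2.1 u') : Circle) : ℂ) * (((ψ (t.1 ⬝ᵥ a') : Circle) : ℂ) * F t))
        (νγ.prod (νβ.prod να)) := by
      have h1 : Integrable (fun t : (γ → K) × ((β → K) × (α → K)) => ((ψ (q t.2.1 u') : Circle) : ℂ) * F t) (νγ.prod (νβ.prod να)) :=
        integrable_of_mem_schwartzBruhat _ hG
      have h2 : Continuous fun t : (γ → K) × ((β → K) × (α → K)) => ((ψ (t.1 ⬝ᵥ a') : Circle) : ℂ) :=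
        continuous_subtype_val.comp (hψ.1.comp ((continuous_dotProduct_left a').comp continuous_fst))
      refine ((h1.bdd_mul (c := 1) h2.aestronglyMeasurable (Filter.Eventually.of_forall fun t => le_of_eq (Circle.norm_coe _)))).congr ?_
      exact Filter.Eventually.of_forall fun t => by ring
    rw [integral_prod _ hint, piFourierSB_apply]
    refine integral_congr_ae (Filter.Eventually.of_forall fun c => ?_)
    have h3 : ∀ s : (β → K) × (α → K), ((ψ (q s.1 u') : Circle) : ℂ) * (((ψ (c ⬝ᵥ a') : Circle) : ℂ) * F (c, s)) =
        ((ψ (c ⬝ᵥ a') : Circle) : ℂ) * (((ψ (q s.1 u') : Circle) : ℂ) * F (c, s)) := fun s => by ring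
    show ∫ s, ((ψ (q s.1 u') : Circle) : ℂ) * (((ψ (c ⬝ᵥ a') : Circle) : ℂ) * F (c, s)) ∂(νβ.prod να) = ((ψ (c ⬝ᵥ a') : Circle) : ℂ) * g c
    simp_rw [h3]
    exact integral_const_mul _ _
  simp_rw [hinner]
  -- (ii) Fourier inversion at `0`
  rw [integral_piFourierSB_eq_mul_apply_zero νγ hψ hm hgS]
  -- (iii) `g(0) = ∫_u ψ(q u u′) ∫_a F(0,(u,a))`
  congr 1
  rw [hg]
  show ∫ s, ((ψ (q s.1 u') : Circle) : ℂ) * F (0, s) ∂(νβ.prod να) = _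
  rw [integral_prod _ (integrable_modulation_slice νβ να q hψ hq u' hF 0)]
  refine integral_congr_ae (Filter.Eventually.of_forall fun u => ?_)
  show ∫ a, ((ψ (q u u') : Circle) : ℂ) * F (0, (u, a)) ∂να = ((ψ (q u u') : Circle) : ℂ) * ∫ a, F (0, (u, a)) ∂να
  exact integral_const_mul _ _

end Core

/-! ## §3 The Fourier clause for `krFun` -/

section Frame

variable {X : Type*} [TopologicalSpace X] [AddCommGroup X] [Module K X] [MeasurableSpace X] (μX : Measure X)
  {Y : Type*} [AddCommGroup Y] [Module K Y] [TopologicalSpace Y] {β' γ' : Type*}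
  (θX : X ≃ₜ ((β ⊕ γ) ⊕ α → K)) (θY : Y ≃ₜ ((β' ⊕ γ') ⊕ γ → K))
  (B : X →ₗ[K] Y →ₗ[K] K) (q : (β → K) →ₗ[K] (β' → K) →ₗ[K] K)

/-- **THE FOURIER CLAUSE OF THE KUDLA–RALLIS ∕ IKEDA MAP** — `r ∘ 𝓕_X = c · 𝓕_β ∘ r`.  Frames `θ_X : X ≃ₜ K^{(β⊕γ)⊕α}`, `θ_Y : Y ≃ₜ K^{(β′⊕γ′)⊕γ}` (the integrated
block of `Y` is indexed by `γ`, dual to the killed block of `X`); hypotheses: (`hB`) on the slices of `Y` the pairing reads `B x (krPoint θ_Y u′ a′) = q(x_β, u′) + ⟨x_γ, a′⟩`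
(`X′ ⟂ X′`, `X′ ⟂ a′`, `X′` dual to `Y′`); (`hμ`) the measure of `X` is the block product `ν_γ ⊗ (ν_β ⊗ ν_α)` read through `θ_X`; (`hΦ`) `Φ` read in block coordinates is
Schwartz–Bruhat.  THEN, for every `u′`:
**`krFun θ_Y ν_γ (betaFourier B ψ μ_X Φ) u′ = c · betaFourier q ψ ν_β (krFun θ_X ν_α Φ) u′`**, `c = piSelfDualConst K γ ν_γ m` (`= 1` for self-dual `ν_γ`) — the Weyl
elements of the two Schrödinger models (★ `betaFourier`) are intertwined by `r`. [cite: GanQiuTakeda2014, §2.8] [cite: KudlaRallis1994, §1] [cite: MoeglinVignerasWaldspurger1987, Chap. 2 II.6] -/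
theorem krFun_betaFourier_eq (hψ : ψ.IsContinuousNontrivial) (hm : ψ.HasConductorExp m) (hq : ∀ w : β' → K, Continuous fun u : β → K => q u w)
    (hB : ∀ (x : X) (u' : β' → K) (a' : γ → K),
      B x (krPoint θY u' a') = q (fun b => θX x (Sum.inl (Sum.inl b))) u' + (fun j => θX x (Sum.inl (Sum.inr j))) ⬝ᵥ a')
    (hμ : ∀ H : X → ℂ, ∫ x, H x ∂μX = ∫ t : (γ → K) × ((β → K) × (α → K)), H (θX.symm (Sum.elim (Sum.elim t.2.1 t.1) t.2.2)) ∂(νγ.prod (νβ.prod να)))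
    {Φ : X → ℂ} (hΦ : (fun t : (γ → K) × ((β → K) × (α → K)) => Φ (θX.symm (Sum.elim (Sum.elim t.2.1 t.1) t.2.2))) ∈ SchwartzBruhat ((γ → K) × ((β → K) × (α → K))))
    (u' : β' → K) :
    krFun θY νγ (betaFourier B ψ μX Φ) u' = (piSelfDualConst K γ νγ m : ℂ) * betaFourier q ψ νβ (krFun θX να Φ) u' := by
  -- unfold the left side and read the pairing on the slices
  have h1 : ∀ a' : γ → K, betaFourier B ψ μX Φ (krPoint θY u' a') =
      ∫ t : (γ → K) × ((β → K) × (α → K)), ((ψ (q t.2.1 u') : Circle) : ℂ) * (((ψ (t.1 ⬝ᵥ a') : Circle) : ℂ) *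
        Φ (θX.symm (Sum.elim (Sum.elim t.2.1 t.1) t.2.2))) ∂(νγ.prod (νβ.prod να)) := by
    intro a'
    rw [betaFourier_apply, hμ]
    refine integral_congr_ae (Filter.Eventually.of_forall fun t => ?_)
    have hβ : (fun b => θX (θX.symm (Sum.elim (Sum.elim t.2.1 t.1) t.2.2)) (Sum.inl (Sum.inl b))) = t.2.1 := by
      funext b; rw [Homeomorph.apply_symm_apply]; rfl
    have hγ : (fun j => θX (θX.symm (Sum.elim (Sum.elim t.2.1 t.1) t.2.2)) (Sum.inl (Sum.inr j))) = t.1 := by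
      funext j; rw [Homeomorph.apply_symm_apply]; rfl
    show ((ψ (B (θX.symm (Sum.elim (Sum.elim t.2.1 t.1) t.2.2)) (krPoint θY u' a')) : Circle) : ℂ) * Φ (θX.symm (Sum.elim (Sum.elim t.2.1 t.1) t.2.2)) = _
    rw [hB, hβ, hγ, AddChar.map_add_eq_mul, Circle.coe_mul, mul_assoc]
  unfold krFun
  simp_rw [h1]
  rw [integral_integral_fourierSlice_eq νβ να νγ q hψ hm hq u' hΦ, betaFourier_apply]
  rfl

end Frame

end Summit.HodgeConjecture.HodgeConjecture.Cruxes.HLiu418.K2LiuKudlaRallisMapFourier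

end
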